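import Summits.BirchSwinnertonDyer.Rank1Residual.ManinAdditive.KMCuspTate
import Literature.NumberTheory.EllipticCurves.ModularCurveSturmProofs
import HarnessLib

/-!
# E-desc-96 `KMCuspTate.KMTateLawAtEight` is FALSE AS TYPED — the degenerate level `N = 8`
# (cell bsd-f2-manin, REF1 statement audit of ty p681467 / desc MEMO-desc §33; supports C2 `ManinOddAtFour`, stmt-BirchSwinnertonDyer-22967)

CLASS: refuted-misstated.  The fitted law E-desc-96 predicts `#Ĥ⁰(⟨w_8⟩, Λ) = 2^{e₂(N/8)/2 + [ss(N) = 0]}` for every `8 ∥ N`.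
At `N = 8` (`M = N/8 = 1`, outside the census `8M ≤ 440`, `M` odd `≥ 3`) the integer divisions truncate: `e₂(1) = 1` (empty
product), `ν₈(8) = alFixedPointCount 8 8 = h(−32) = 2`, so `ssRationalCountAtTwo 8 = 2/4 + 1/2 = 0` and the predicted order is
`2^{0 + 1} = 2`; but `S₂(Γ₀(8)) = 0` (tree theorem `cuspForm_two_gamma0_eq_zero_of_le_ten`), so the Katz–Mazur lattice is `0` and
every Tate order at level `8` equals `1 ≠ 2`.  WITNESS: `N = 8`.  REPAIRED STATEMENT `C′` (believed to be what desc intends; the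
witness misses it): add the binder `N ≠ 8` (equivalently `24 ≤ N`, i.e. `M = N/8 ≥ 3`):
`∀ (N : ℕ) [NeZero N], 8 ∣ N → ¬ 16 ∣ N → N ≠ 8 → <the two order identities of KMTateLawAtEight>`.
Nothing else of `KMCuspTate.lean` fails at the degenerate levels `N ∈ {4, 8, 12}` (E-desc-91/91♯/92/93/94/97 evaluate to true
there; checked on paper in REF1 §R105).  BSD is not proved by this; Manin's conjecture is not proved by this; C2 OPEN.
-/

set_option autoImplicit false
set_option linter.dupNamespace false

open scoped MatrixGroups ModularForm

open CongruenceSubgroup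
open Summit.BirchSwinnertonDyer.Rank1Residual.ManinAdditive
open Literature.NumberTheory.EllipticCurves.ModularForms (cuspForm_two_gamma0_eq_zero_of_le_ten)

namespace Summit.BirchSwinnertonDyer.BirchSwinnertonDyer.Theorems.ManinOddAtFour.Negative

/-- `h(−32) = 2` as a reduced-form count (the two primitive reduced forms `(1,0,8)`, `(3,2,3)`). [folklore] -/
theorem reducedFormCount_neg_thirtyTwo : ALTateCohomology.reducedFormCount (-32) = 2 := by
  decide +kernel

/-- `ν₈(8) = alFixedPointCount 8 8 = 2` (empty Euler factor at `N/8 = 1`). [folklore] -/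
theorem alFixedPointCount_eight_eight : ALTateCohomology.alFixedPointCount 8 8 = 2 := by
  rw [ALTateCohomology.alFixedPointCount]
  norm_num [reducedFormCount_neg_thirtyTwo]

/-- `e₂(1) = 1` (empty product). [folklore] -/
theorem ellipticTwoCount_one : KMCuspTate.ellipticTwoCount 1 = 1 := by
  simp [KMCuspTate.ellipticTwoCount]

/-- The truncating integer divisions at `N = 8`: `ssRationalCountAtTwo 8 = 2/4 + 1/2 = 0`. [folklore] -/
theorem ssRationalCountAtTwo_eight : KMCuspTate.ssRationalCountAtTwo 8 = 0 := by
  rw [KMCuspTate.ssRationalCountAtTwo, alFixedPointCount_eight_eight, KMCuspTate.ellipticTwoCount]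
  norm_num

/-- At level `8` every Tate order is `1`: `S₂(Γ₀(8)) = 0`, so every sublattice is `0`. [folklore] -/
theorem tateOrder_level_eight (L : Submodule ℤ (CuspForm (Gamma0 8) 2))
    (w : CuspForm (Gamma0 8) 2 →ₗ[ℤ] CuspForm (Gamma0 8) 2) (ε : ℤ) : ALTateCohomology.tateOrder L w ε = 1 := by
  have hs : ∀ f : CuspForm (Gamma0 8) 2, f = 0 := cuspForm_two_gamma0_eq_zero_of_le_ten (by norm_num)
  unfold ALTateCohomology.tateOrder
  have hbot : (L ⊓ LinearMap.ker (w - ε • LinearMap.id)).toAddSubgroup = ⊥ := by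
    rw [eq_bot_iff]
    intro x _
    rw [AddSubgroup.mem_bot]
    exact hs x
  rw [hbot, AddSubgroup.relIndex_bot_right]

/-- **E-desc-96 `KMTateLawAtEight` is false as typed** [refuted-misstated]: at `N = 8` its first conjunct reads `1 = 2`.
Repaired statement: add `N ≠ 8` (census range `M = N/8 ≥ 3`); the witness misses the repair. [folklore] -/
theorem kmTateLawAtEight_false : ¬ KMCuspTate.KMTateLawAtEight := by
  intro h
  have h8 := (h 8 ⟨8 / 8, rfl⟩ (by decide)).1
  rw [tateOrder_level_eight, ssRationalCountAtTwo_eight,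
    show (8 : ℕ) / 8 = 1 from rfl, ellipticTwoCount_one] at h8
  norm_num at h8

end Summit.BirchSwinnertonDyer.BirchSwinnertonDyer.Theorems.ManinOddAtFour.Negative
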